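/-
Copyright (c) 2026 the pub-hodgecm-mathlib formalisation cell (harness21).  Prover seat hodgecm-mathlib-K2E4-p08 (g2), Track B «K2-LIT» ∕ h413, ‹S› ROAD J brick J1′, rung 2:
the descent at the second (compact) class WITH THE VALUE of the descended function at the centre of the dock.  2026-09-04.
-/
import Literature.NumberTheory.Rogawski1990.LocalTransferSecondClassDescentCM   -- ★ p842329 A-p17 (g21): (D2ε′)+(sat′); this file is its twin with the value at `ε′` threaded through
import HarnessLib

/-!
# Descent at the second class `ε′` read on the compact dock `C′ = Z(ε′)`, WITH THE VALUE AT THE CENTRE — road J brick J1′, rung 2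

Twin of ★ `exists_isLocallyConstant_descent_secondClass` (p842329; [Rogawski1990, §8.1 Prop. 8.1.3 pp. 110–111, §8.2 Prop. 8.2.1 (d)], [HarishChandra1970, Part I §3 Lemmas 19–21]):
same binders, same conclusion, plus ONE conjunct — the descended locally constant function `ψ_ε` on `C′ = Z_{G′_v}(ε′)` takes at the centre `ε′` the value
**`ψ_ε(ε′) = ν′(C′)⁻¹ · ∫_{G′_v} ψ(y ε′ y⁻¹) dν_G(y)`** (a convergent Haar integral: `y ↦ ψ(y ε′ y⁻¹)` is supported on the compact `C·Z(ε′)` of Harish-Chandra's compactness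
lemma).  The proof is p842329's token for token (`ψ_ε := ν′(C′)⁻¹ · I`, `I(m) = ∫ β(y) ψ(y m y⁻¹) dν_G` with the cut-off `β ≡ 1` on `C·Z(ε′)`), plus the observation that the
cut-off is invisible at `m = ε′ ∈ B₁`.  Consumed by the compact-side junction with value (road J, J1′ rung 3): there `Ψ(ε_C) = ∫_{C′} ψ_ε(k ε′ k⁻¹) dν′(k) = ∫_{G′_v} ψ(y ε′ y⁻¹) dν_G`.

* **`exists_isLocallyConstant_descent_secondClass_and_apply_centre`**.

HONEST LABEL: a Literature-side helper toward h413 (`stmt-HodgeConjecture-24833`); HC_CM is proved only modulo its printed citations until rung 0 closes.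
-/

set_option autoImplicit false

noncomputable section

open NumberField IsDedekindDomain Matrix Topology Set Filter MeasureTheory MeasureTheory.Measure
open scoped MatrixGroups Pointwise

namespace Literature.NumberTheory.Rogawski1990

open Literature.NumberTheory.Automorphic Literature.NumberTheory.Automorphic.UnitaryGroup Literature.NumberTheory.GaloisRepresentations
open Literature.MeasureTheory.Group
open Literature.AlgebraicGeometry.ShimuraVarieties (unitaryGroup)

section SecondClassValue

variable (L : Type) [Field L] [NumberField L] [IsCMField L] (H' : Matrix (Fin 3) (Fin 3) L) (v : HeightOneSpectrum (𝓞 ↥(maximalRealSubfield L)))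

variable [MeasurableSpace ((UnitaryGroup.cmDatum L 3 H').Local v)] [BorelSpace ((UnitaryGroup.cmDatum L 3 H').Local v)]
  [iG : ∀ γ : ((UnitaryGroup.cmDatum L 3 H').Local v), MeasurableSpace (((UnitaryGroup.cmDatum L 3 H').Local v) ⧸ Subgroup.centralizer ({γ} : Set ((UnitaryGroup.cmDatum L 3 H').Local v)))]
  [bG : ∀ γ : ((UnitaryGroup.cmDatum L 3 H').Local v), BorelSpace (((UnitaryGroup.cmDatum L 3 H').Local v) ⧸ Subgroup.centralizer ({γ} : Set ((UnitaryGroup.cmDatum L 3 H').Local v)))]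

/-- **DESCENT AT THE SECOND CLASS WITH THE VALUE AT THE CENTRE**: ★ `exists_isLocallyConstant_descent_secondClass` with the extra conjunct
`ψ_ε(ε′) = ν′(C′)⁻¹ · ∫_{G′_v} ψ(y ε′ y⁻¹) dν_G(y)`. [cite: Rogawski1990, §8.1 Prop. 8.1.3 pp. 110–111; §8.2 Prop. 8.2.1 (d) p. 112] [cite: HarishChandra1970, Part I §3 Lemmas 19–21] -/
theorem exists_isLocallyConstant_descent_secondClass_and_apply_centre
    (hH' : (H'.map (cmConjRingHom L))ᵀ = H') (hdet' : H'.det ≠ 0)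
    (w : UnitaryGroup.PlacesOver L v) (hw : IsCMField.complexConj L • w.1 = w.1)
    (νG : Measure ((UnitaryGroup.cmDatum L 3 H').Local v)) [νG.IsHaarMeasure] [νG.IsMulRightInvariant]
    {mG : OrbitalMeasureFamily ((UnitaryGroup.cmDatum L 3 H').Local v)}
    (hmG : mG.IsCanonical (fun γ => IsRegularElt (γ.val : GL (Fin 3) (UnitaryGroup.LocalRing L v))) νG)
    (εH : (UnitaryGroup.cmDatum L 2 (Matrix.of fun i j : Fin 2 => if i.val + j.val + 1 = 2 then (1 : L) else 0)).Local v ×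
      (UnitaryGroup.cmDatum L 1 (Matrix.of fun i j : Fin 1 => if i.val + j.val + 1 = 1 then (1 : L) else 0)).Local v) (a : UnitaryGroup.LocalRing L v)
    (ha : (εH.1.val.val : Matrix (Fin 2) (Fin 2) (UnitaryGroup.LocalRing L v)) = a • (1 : Matrix (Fin 2) (Fin 2) (UnitaryGroup.LocalRing L v)))
    (hu : (εH.2.val.val : Matrix (Fin 1) (Fin 1) (UnitaryGroup.LocalRing L v)) 0 0 ≠ a)
    {P' : GL (Fin 3) (UnitaryGroup.LocalRing L v)} {G₁' : Matrix (Fin 2) (Fin 2) (UnitaryGroup.LocalRing L v)} {G₂' : Matrix (Fin 1) (Fin 1) (UnitaryGroup.LocalRing L v)}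
    (hP' : twistGram (UnitaryGroup.conjLocal L (IsCMField.complexConj L) v) ((UnitaryGroup.adelicForm L 3 H').map (UnitaryGroup.adeleToLocal L v)) P'.val =
      finSum 2 1 G₁' G₂')
    (hanis' : ∀ x : Fin 2 → UnitaryGroup.LocalRing L v, hermForm (UnitaryGroup.conjLocal L (IsCMField.complexConj L) v) G₁' x x = 0 → x = 0)
    (ε' : (UnitaryGroup.cmDatum L 3 H').Local v)
    (hε' : (ε'.val.val : Matrix (Fin 3) (Fin 3) (UnitaryGroup.LocalRing L v)) * P'.val =
      P'.val * finSum 2 1 (a • (1 : Matrix (Fin 2) (Fin 2) (UnitaryGroup.LocalRing L v))) (εH.2.val.val : Matrix (Fin 1) (Fin 1) (UnitaryGroup.LocalRing L v)))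
    -- the `C′`-side data at `C′ := Z(ε′)`
    [MeasurableSpace ↥(Subgroup.centralizer ({ε'} : Set ((UnitaryGroup.cmDatum L 3 H').Local v)))]
    [BorelSpace ↥(Subgroup.centralizer ({ε'} : Set ((UnitaryGroup.cmDatum L 3 H').Local v)))]
    [LocallyCompactSpace ↥(Subgroup.centralizer ({ε'} : Set ((UnitaryGroup.cmDatum L 3 H').Local v)))]
    [∀ m : ↥(Subgroup.centralizer ({ε'} : Set ((UnitaryGroup.cmDatum L 3 H').Local v))),
      MeasurableSpace (↥(Subgroup.centralizer ({ε'} : Set ((UnitaryGroup.cmDatum L 3 H').Local v))) ⧸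
        Subgroup.centralizer ({m} : Set ↥(Subgroup.centralizer ({ε'} : Set ((UnitaryGroup.cmDatum L 3 H').Local v)))))]
    [∀ m : ↥(Subgroup.centralizer ({ε'} : Set ((UnitaryGroup.cmDatum L 3 H').Local v))),
      BorelSpace (↥(Subgroup.centralizer ({ε'} : Set ((UnitaryGroup.cmDatum L 3 H').Local v))) ⧸
        Subgroup.centralizer ({m} : Set ↥(Subgroup.centralizer ({ε'} : Set ((UnitaryGroup.cmDatum L 3 H').Local v)))))]
    (ν' : Measure ↥(Subgroup.centralizer ({ε'} : Set ((UnitaryGroup.cmDatum L 3 H').Local v)))) [ν'.IsHaarMeasure] [ν'.IsMulRightInvariant]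
    (P'' : ↥(Subgroup.centralizer ({ε'} : Set ((UnitaryGroup.cmDatum L 3 H').Local v))) → Prop)
    (hP'' : ∀ m : ↥(Subgroup.centralizer ({ε'} : Set ((UnitaryGroup.cmDatum L 3 H').Local v))),
      IsRegularElt ((m.1.val : GL (Fin 3) (UnitaryGroup.LocalRing L v))) → P'' m)
    {m' : OrbitalMeasureFamily ↥(Subgroup.centralizer ({ε'} : Set ((UnitaryGroup.cmDatum L 3 H').Local v)))} (hm' : m'.IsCanonical P'' ν') :
    ∀ ψ : ((UnitaryGroup.cmDatum L 3 H').Local v) → ℂ, IsLocSmooth ψ →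
      ∃ ψε : ↥(Subgroup.centralizer ({ε'} : Set ((UnitaryGroup.cmDatum L 3 H').Local v))) → ℂ, IsLocallyConstant ψε ∧
        ψε ⟨ε', Subgroup.mem_centralizer_singleton_iff.2 rfl⟩ = (((ν'.real Set.univ)⁻¹ : ℝ) : ℂ) * ∫ y, ψ (y * ε' * y⁻¹) ∂νG ∧
        ∀ B' ∈ 𝓝 (⟨ε', Subgroup.mem_centralizer_singleton_iff.2 rfl⟩ : ↥(Subgroup.centralizer ({ε'} : Set ((UnitaryGroup.cmDatum L 3 H').Local v)))),
          ∃ V ∈ 𝓝 εH, ∀ γH ∈ V, IsLocalGRegular L v γH →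
            ∀ c : ConjClasses ((UnitaryGroup.cmDatum L 3 H').Local v),
              (∃ x : ((UnitaryGroup.cmDatum L 3 H').Local v), (∃ B : Matrix (Fin 2) (Fin 2) (UnitaryGroup.LocalRing L v),
                ((x * Quotient.out c * x⁻¹).val.val : Matrix (Fin 3) (Fin 3) (UnitaryGroup.LocalRing L v)) * P'.val =
                  P'.val * finSum 2 1 B (γH.2.val.val : Matrix (Fin 1) (Fin 1) (UnitaryGroup.LocalRing L v)))) →
              IsLocalNormPair L H' v γH (Quotient.out c) →
                ∃ m ∈ B', P'' (Quotient.out (ConjClasses.mk m)) ∧ classOrbitalIntegral mG ψ c = classOrbitalIntegral m' ψε (ConjClasses.mk m) := by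
  classical
  intro ψ hψ
  haveI : Algebra.IsQuadraticExtension ↥(maximalRealSubfield L) L := IsCMField.isQuadraticExtension L
  have hv : Subsingleton (UnitaryGroup.PlacesOver L v) :=
    UnitaryGroup.PlacesOver.subsingleton_of_smul_eq (IsCMField.complexConj L) (IsCMField.complexConj_ne_one L) w hw
  set σ := UnitaryGroup.conjLocal L (IsCMField.complexConj L) v with hσdef
  set Hv := (UnitaryGroup.adelicForm L 3 H').map (UnitaryGroup.adeleToLocal L v) with hHvdef
  set εC : ↥(Subgroup.centralizer ({ε'} : Set ((UnitaryGroup.cmDatum L 3 H').Local v))) := ⟨ε', Subgroup.mem_centralizer_singleton_iff.2 rfl⟩ with hεCdef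
  set u : UnitaryGroup.LocalRing L v := (εH.2.val.val : Matrix (Fin 1) (Fin 1) (UnitaryGroup.LocalRing L v)) 0 0 with hudef
  have hHvd : IsUnit Hv.det := isUnit_det_localForm L 3 H' v hdet'
  have hU1 : (εH.2.val.val : Matrix (Fin 1) (Fin 1) (UnitaryGroup.LocalRing L v)) = u • (1 : Matrix (Fin 1) (Fin 1) _) := by
    ext i k; fin_cases i; fin_cases k; simp [hudef]
  have hε'D : (ε'.val.val : Matrix (Fin 3) (Fin 3) (UnitaryGroup.LocalRing L v)) * P'.val =
      P'.val * finSum 2 1 (a • (1 : Matrix (Fin 2) (Fin 2) (UnitaryGroup.LocalRing L v))) (u • (1 : Matrix (Fin 1) (Fin 1) (UnitaryGroup.LocalRing L v))) := by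
    rw [← hU1]; exact hε'
  have hau : IsUnit (a - u) := isUnit_localRing_of_ne_zero_of_subsingleton L v hv (sub_ne_zero.2 (Ne.symm hu))
  have hu1 : u * σ u = 1 := by rw [mul_comm]; exact conjLocal_finGammaTwo_mul_finGammaTwo L v εH
  -- `C′ = Z(ε′)` is compact
  have hd' : G₁'.det * G₂' 0 0 = σ P'.val.det * Hv.det * P'.val.det := by
    rw [← Matrix.det_fin_one G₂', ← det_finSum, ← hP', det_twistGram]
  have hG₂'u : IsUnit (G₂' 0 0) := by
    refine isUnit_of_mul_isUnit_right (?_ : IsUnit (G₁'.det * G₂' 0 0))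
    rw [hd']
    exact (((Matrix.isUnits_det_units P').map σ).mul hHvd).mul (Matrix.isUnits_det_units P')
  haveI hZc : CompactSpace ↥(Subgroup.centralizer ({ε'} : Set ((UnitaryGroup.cmDatum L 3 H').Local v))) := compactSpace_centralizer_of_frame_of_anisotropic L v H' ε' w hw hau hε'D hP' hanis' hG₂'u
  -- (2) Harish-Chandra's compactness at `ε′` (★ A-p16) and the cut-off
  obtain ⟨B₁, -, hB₁o, hεB₁, hwin⟩ := exists_isCompact_isOpen_nhds_conj_mem_imp_mem_mul_centralizer L (N₁ := 2) H' hH' (isUnit_iff_ne_zero.2 hdet') w hw ε' P'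
    (Ne.symm hu) hu1 hε'D
  obtain ⟨C, hCc, hC⟩ := hwin (tsupport ψ) hψ.2
  have hS₀ : IsCompact (C * ((Subgroup.centralizer ({ε'} : Set ((UnitaryGroup.cmDatum L 3 H').Local v))) : Set ((UnitaryGroup.cmDatum L 3 H').Local v))) := hCc.mul (isCompact_iff_compactSpace.2 hZc)
  obtain ⟨β, hβ1, -, hβc, -⟩ := exists_continuous_one_zero_of_isCompact hS₀ isClosed_empty (Set.disjoint_empty _)
  set I : ↥(Subgroup.centralizer ({ε'} : Set ((UnitaryGroup.cmDatum L 3 H').Local v))) → ℂ := fun m => ∫ y, (β y) • ψ (y * (m : (UnitaryGroup.cmDatum L 3 H').Local v) * y⁻¹) ∂νG with hIdef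
  have hIloc : IsLocallyConstant I := isLocallyConstant_integral_conj νG (Subgroup.centralizer ({ε'} : Set ((UnitaryGroup.cmDatum L 3 H').Local v))) hβc hψ.1
  have hIB₁ : ∀ t ∈ B₁, I t = ∫ y, ψ (y * (t : (UnitaryGroup.cmDatum L 3 H').Local v) * y⁻¹) ∂νG := by
    intro t ht
    refine congrArg (integral νG) (funext fun y => ?_)
    by_cases hψy : ψ (y * (t : (UnitaryGroup.cmDatum L 3 H').Local v) * y⁻¹) = 0
    · rw [hψy, smul_zero]
    · have hy : y ∈ C * ((Subgroup.centralizer ({ε'} : Set ((UnitaryGroup.cmDatum L 3 H').Local v))) : Set ((UnitaryGroup.cmDatum L 3 H').Local v)) := hC y t ht (subset_tsupport _ (Function.mem_support.2 hψy))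
      rw [show β y = 1 from hβ1 hy, one_smul]
  set cst : ℂ := (((ν'.real Set.univ)⁻¹ : ℝ) : ℂ) with hcst
  refine ⟨fun m => cst * I m, hIloc.comp fun z => cst * z, ?_, ?_⟩
  · -- the VALUE AT THE CENTRE: the cut-off `β` is `1` along the orbit of `ε′ ∈ B₁`
    show cst * I εC = cst * ∫ y, ψ (y * ε' * y⁻¹) ∂νG
    rw [hIB₁ εC hεB₁]
  intro B' hB'
  -- (3) a `C′`-conjugation-invariant shrinking of `B₁`
  have hB₁n : B₁ ∈ 𝓝 εC := hB₁o.mem_nhds hεB₁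
  have hB₂ : ∀ᶠ m in 𝓝 εC, ∀ k ∈ (Set.univ : Set ↥(Subgroup.centralizer ({ε'} : Set ((UnitaryGroup.cmDatum L 3 H').Local v)))), k * m * k⁻¹ ∈ B₁ := by
    apply isCompact_univ.eventually_forall_of_forall_eventually
    intro k _
    have hcont : Continuous fun z : ↥(Subgroup.centralizer ({ε'} : Set ((UnitaryGroup.cmDatum L 3 H').Local v))) × ↥(Subgroup.centralizer ({ε'} : Set ((UnitaryGroup.cmDatum L 3 H').Local v))) => z.2 * z.1 * z.2⁻¹ :=
      (continuous_snd.mul continuous_fst).mul continuous_snd.inv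
    have hkε : k * εC * k⁻¹ = εC := by
      rw [mul_inv_eq_iff_eq_mul]
      have h1 : (k : (UnitaryGroup.cmDatum L 3 H').Local v) * ε' = ε' * k := Subgroup.mem_centralizer_singleton_iff.1 k.2
      exact Subtype.ext h1
    have hmem : (fun z : ↥(Subgroup.centralizer ({ε'} : Set ((UnitaryGroup.cmDatum L 3 H').Local v))) × ↥(Subgroup.centralizer ({ε'} : Set ((UnitaryGroup.cmDatum L 3 H').Local v))) => z.2 * z.1 * z.2⁻¹) ⁻¹' B₁ ∈ 𝓝 (εC, k) :=
      hcont.continuousAt.preimage_mem_nhds (by show B₁ ∈ 𝓝 (k * εC * k⁻¹); rw [hkε]; exact hB₁n)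
    exact hmem
  obtain ⟨V, hV, hVS⟩ := exists_nhds_forall_frameRep_mem_centralizer_nhds L v H' w hw hHvd εH a ha hu hP' hanis' ε' hε' _ (inter_mem hB' hB₂)
  refine ⟨V, hV, ?_⟩
  rintro γH hγV hreg c ⟨x, B, hxP⟩ hpair
  set g : (UnitaryGroup.cmDatum L 3 H').Local v := x * Quotient.out c * x⁻¹ with hgdef
  have hpair' : IsLocalNormPair L H' v γH g := (isLocalNormPair_conj_right L v H' γH (Quotient.out c) x).2 hpair
  have hgreg : IsRegularElt (g.val : GL (Fin 3) (UnitaryGroup.LocalRing L v)) := isRegularElt_of_isLocalNormPair L H' v hpair' hreg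
  obtain ⟨hgZ, hgB⟩ := hVS γH hγV g ⟨B, hxP⟩ hpair'
  set m : ↥(Subgroup.centralizer ({ε'} : Set ((UnitaryGroup.cmDatum L 3 H').Local v))) := ⟨g, hgZ⟩ with hmdef
  have hmk : ConjClasses.mk g = c := (ConjClasses.mk_eq_mk_iff_isConj.2 (isConj_iff.2 ⟨x, rfl⟩)).symm.trans (Quotient.out_eq c)
  -- `P″` at the class of `m`: a conjugate of the regular `g`
  have hP''m : P'' (Quotient.out (ConjClasses.mk m)) := by
    obtain ⟨k, hk⟩ := isConj_iff.1 (ConjClasses.mk_eq_mk_iff_isConj.1 (Quotient.out_eq (ConjClasses.mk m)).symm)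
    apply hP''
    rw [← hk]
    show IsRegularElt ((k.1 * g * k.1⁻¹).val : GL (Fin 3) (UnitaryGroup.LocalRing L v))
    exact (isRegularElt_conj_iff _ _).2 hgreg
  refine ⟨m, hgB.1, hP''m, ?_⟩
  -- (1) the `G′`-side: compact centraliser, plain Haar integral
  haveI : CompactSpace ↥(Subgroup.centralizer ({g} : Set ((UnitaryGroup.cmDatum L 3 H').Local v))) :=
    compactSpace_centralizer_of_commute_of_isRegularElt L v H' hgreg (Subgroup.mem_centralizer_singleton_iff.1 hgZ)
  have hiso : IsConj g (Quotient.out c) := isConj_iff.2 ⟨x⁻¹, by rw [hgdef]; group⟩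
  haveI : CompactSpace ↥(Subgroup.centralizer ({(Quotient.out c : (UnitaryGroup.cmDatum L 3 H').Local v)} : Set ((UnitaryGroup.cmDatum L 3 H').Local v))) :=
    compactSpace_centralizer_of_isConj hiso
  have hψc : Continuous ψ := hψ.1.continuous
  have hcreg : IsRegularElt ((Quotient.out c).val : GL (Fin 3) (UnitaryGroup.LocalRing L v)) := isRegularElt_of_isLocalNormPair L H' v hpair hreg
  rw [IsCanonical.classOrbitalIntegral_eq_integral_conj_of_compactSpace_centralizer hmG hcreg ψ hψc g hmk]
  -- (3) the `C′`-side: a Haar average of the locally constant `ψε` over the compact `C′`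
  have hψεc : Continuous fun n : ↥(Subgroup.centralizer ({ε'} : Set ((UnitaryGroup.cmDatum L 3 H').Local v))) => cst * I n := (hIloc.comp fun z => cst * z).continuous
  rw [hm'.classOrbitalIntegral_eq_integral_conj_of_mk_eq ν' hP''m (fun n : ↥(Subgroup.centralizer ({ε'} : Set ((UnitaryGroup.cmDatum L 3 H').Local v))) => cst * I n) hψεc m rfl]
  have hk : ∀ k : ↥(Subgroup.centralizer ({ε'} : Set ((UnitaryGroup.cmDatum L 3 H').Local v))), cst * I (k * m * k⁻¹) = cst * ∫ y, ψ (y * g * y⁻¹) ∂νG := by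
    intro k
    have hkm : k * m * k⁻¹ ∈ B₁ := hgB.2 k (Set.mem_univ k)
    rw [hIB₁ _ hkm]
    congr 1
    have hcoe : ((k * m * k⁻¹ : ↥(Subgroup.centralizer ({ε'} : Set ((UnitaryGroup.cmDatum L 3 H').Local v)))) : (UnitaryGroup.cmDatum L 3 H').Local v) = k.1 * g * k.1⁻¹ := rfl
    rw [hcoe]
    have h3 : ∀ y : (UnitaryGroup.cmDatum L 3 H').Local v, y * (k.1 * g * k.1⁻¹) * y⁻¹ = (y * k.1) * g * (y * k.1)⁻¹ := fun y => by group
    simp_rw [h3]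
    exact integral_mul_right_eq_self (fun y => ψ (y * g * y⁻¹)) k.1
  simp_rw [hk]
  rw [integral_const, Complex.real_smul, hcst, Complex.ofReal_inv, mul_inv_cancel_left₀]
  -- `ν′(C′) ≠ 0, ∞`
  rw [Ne, Complex.ofReal_eq_zero, measureReal_def, ENNReal.toReal_eq_zero_iff, not_or]
  exact ⟨isOpen_univ.measure_ne_zero ν' Set.univ_nonempty, measure_ne_top ν' _⟩

end SecondClassValue

end Literature.NumberTheory.Rogawski1990
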